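import Literature.NumberTheory.LFunctions.InvZetaMellinBarnes
import Literature.NumberTheory.LFunctions.NymanBeurlingProofs
import Literature.NumberTheory.LFunctions.NymanBeurlingZetaRatio
import Literature.NumberTheory.LFunctions.RHZetaGrowthProofs
import HarnessLib

/-!
# `Literature.NumberTheory.LFunctions.baezDuarte_iff` (Báez-Duarte 2003, Thm. 1.1) — proof

Topic: `Literature/NumberTheory/LFunctions`. Discharge of the named fact `Literature.NumberTheory.LFunctions.baezDuarte_iff`
of `Literature/NumberTheory/LFunctions/RHClassicalEquivalents.lean`: the Riemann hypothesis holds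
iff `χ = 𝟙_{(0,1]}` lies in the `L²(0,∞)`-closure of the span of the natural Beurling functions
`ρ_a(x) = {1/(ax)}`, `a ∈ ℕ` (L. Báez-Duarte, *A strengthening of the Nyman–Beurling criterion
for the Riemann hypothesis*, Atti Accad. Naz. Lincei Rend. Lincei (9) Mat. Appl. 14 (2003),
5–11, Thm. 1.1).

The pieces, all proved in the tree:

* elementary half and reduction to the deep half — `Literature/…/NymanBeurling.lean`
  (`riemannHypothesis_of_beurling_closure`, `baezDuarte_iff_of_onlyIf`);
* the deep half from the abstract Dirichlet-polynomial approximation property of `1/ζ`, Lemma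
  2.2 and Titchmarsh (14.2.5) — `Literature/…/NymanBeurlingProofs.lean`
  (`baezDuarte_onlyIf_of_approx`);
* Lemma 2.2 — `Literature/…/NymanBeurlingZetaRatio.lean` (`baezDuarte_zetaRatio_bound_holds`);
* Titchmarsh (14.2.5) — `Literature/…/RHZetaGrowthProofs.lean`
  (`zeta_isBigO_rpow_of_riemannHypothesis_holds`);
* the approximation property under RH, by smoothed Möbius sums and a Mellin–Barnes contour
  shift — `Literature/…/InvZetaMellinBarnes.lean` and `invZetaDirichletApprox_of_RH` below
  (this replaces Báez-Duarte's Lemma 2.1 = Balazard–Saias, *Notes 1*, Lemme 2, whose sharp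
  partial sums are not needed for Thm. 1.1).

## Main results (all proved)

* `Literature.NumberTheory.LFunctions.invZetaDirichletApprox_of_RH` — RH ⇒ `InvZetaDirichletApprox ε`, `0 < ε ≤ 1/8`.
* `Literature.NumberTheory.LFunctions.baezDuarte_onlyIf_holds` — the deep half of Thm. 1.1.
* `Literature.NumberTheory.LFunctions.baezDuarte_iff_holds` — Báez-Duarte's Theorem 1.1.

## References

* L. Báez-Duarte (2003), Thm. 1.1, Lemmas 2.1–2.2, §2.2 (arXiv:math/0202141).
* E. C. Titchmarsh, *The Theory of the Riemann Zeta-Function*, 2nd ed. (1986), (2.1.5), §14.2,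
  §14.25.
-/

noncomputable section

open Complex Filter Topology Set MeasureTheory
open scoped Real

namespace Literature.NumberTheory.LFunctions

open MellinBarnes
open MertensBoundRH (zetaInv)

/-- **The Dirichlet-polynomial approximation property under RH** (the Lemma 2.1 input of
Báez-Duarte's §2.2 in the abstract form `InvZetaDirichletApprox ε`, realised by the
smoothed truncated sums `∑_{a≤N} μ(a)e^{-a/X}a^{-s}` instead of the sharp partial sums of
Balazard–Saias): for `0 < ε ≤ 1/8` and every `η > 0` there is a real-coefficient Dirichlet
polynomial `D` with `|D(1/2-ε+iτ) - 1/ζ(1/2+ε+iτ)| ≤ η(1+|τ|)^{1/8}` for all `τ` and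
`|D(1) - 1/ζ(1+2ε)| ≤ η`. Proof: `norm_LSeries_smoothedMoebius_sub_zetaInv_le` with `κ = ε/2`,
`σ₀ = 1/2 + ε/2` (choose `X` large), then truncate (choose `N` large, uniformly in `τ`).
[cite: BaezDuarte2003, §2.2 (role of Lemma 2.1)] [cite: Titchmarsh1986, Thm 14.2 (14.2.6)] -/
theorem invZetaDirichletApprox_of_RH (hRH : RiemannHypothesis) {ε : ℝ} (hε : 0 < ε)
    (hε1 : ε ≤ 1 / 8) : InvZetaDirichletApprox ε := by
  intro η hη
  -- the Dirichlet polynomial of `mbCoeff ε X N` is the truncated smoothed sum shifted by `2ε`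
  have hpoly : ∀ (X : ℝ) (N : ℕ) (w : ℂ), dirichletPoly (fun k ↦ (mbCoeff ε X N k : ℂ)) w =
      ∑ a ∈ Finset.range (N + 1), LSeries.term (smoothedMoebius X) (w + 2 * ε) a := by
    intro X N w
    rw [Finset.sum_range_succ', LSeries.term_zero, add_zero, dirichletPoly,
      ← Fin.sum_univ_eq_sum_range (fun a ↦ LSeries.term (smoothedMoebius X) (w + 2 * ε) (a + 1)) N]
    refine Finset.sum_congr rfl fun k _ ↦ ?_
    have hk : (0 : ℝ) ≤ (k : ℕ) + 1 := by positivity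
    have hk' : (((k : ℕ) : ℂ) + 1) ≠ 0 := by exact_mod_cast Nat.succ_ne_zero k
    rw [LSeries.term_of_ne_zero (Nat.succ_ne_zero k)]
    simp only [mbCoeff, smoothedMoebius, Nat.succ_eq_add_one]
    push_cast
    rw [Complex.ofReal_cpow hk]
    push_cast
    simp only [div_eq_mul_inv]
    rw [← cpow_neg, neg_add, cpow_add _ _ hk']
    ring
  set κ : ℝ := ε / 2 with hκ
  have hκ0 : 0 < κ := by positivity
  have hκ2 : κ ≤ 1 / 2 := by rw [hκ]; linarith
  set σ₀ : ℝ := 1 / 2 + ε / 2 with hσ₀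
  have hσ₀' : 1 / 2 < σ₀ := by rw [hσ₀]; linarith
  obtain ⟨C, hC0, hC⟩ := exists_norm_zetaInv_le hRH hσ₀' (δ := 1 / 8) (by norm_num)
  set Iκ : ℝ := ∫ y : ℝ, ‖Complex.Gamma (-κ + y * I)‖ * (1 + |y|) ^ (1 / 8 : ℝ) with hIκ
  set K : ℝ := C * Iκ / π + C with hK
  -- choose `X`
  have hXev : ∀ᶠ X : ℝ in atTop, K * X ^ (-κ) < η / 2 := by
    have h := (tendsto_rpow_neg_atTop hκ0).const_mul K
    rw [mul_zero] at h
    exact h.eventually (gt_mem_nhds (by positivity))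
  obtain ⟨X, hXK, hX1⟩ := (hXev.and (eventually_ge_atTop 1)).exists
  have hX0 : 0 < X := by linarith
  have hmain : ∀ s : ℂ, σ₀ + κ ≤ s.re →
      ‖LSeries (smoothedMoebius X) s - zetaInv s‖ ≤ η / 2 * (1 + |s.im|) ^ (1 / 8 : ℝ) := by
    intro s hs
    refine (norm_LSeries_smoothedMoebius_sub_zetaInv_le hRH hκ0 hκ2 hσ₀' hC0.le hC hX1 hs).trans ?_
    exact mul_le_mul_of_nonneg_right hXK.le (by positivity)
  -- choose `N`
  have hNev : ∀ᶠ n : ℕ in atTop, ∑' a : ℕ, Real.exp (-((a + n : ℕ) / X)) < η / 2 :=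
    (tendsto_tail_exp X).eventually (gt_mem_nhds (by positivity))
  obtain ⟨N₀, hN₀⟩ := eventually_atTop.1 hNev
  set N : ℕ := N₀ with hN
  have htrunc : ∀ w : ℂ, 0 ≤ w.re →
      ‖LSeries (smoothedMoebius X) w -
        ∑ a ∈ Finset.range (N + 1), LSeries.term (smoothedMoebius X) w a‖ ≤ η / 2 :=
    fun w hw ↦ (norm_LSeries_sub_sum_le hX0 hw (N + 1)).trans (hN₀ (N + 1) (by omega)).le
  refine ⟨N, mbCoeff ε X N, fun τ ↦ ?_, ?_⟩
  · -- on the line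
    set s : ℂ := 1 / 2 + ε + τ * I with hs
    have hw2 : (1 / 2 - ε + τ * I : ℂ) + 2 * ε = s := by rw [hs]; ring
    have hsre : s.re = 1 / 2 + ε := by simp [hs]
    have hsim : s.im = τ := by simp [hs]
    have hs1 : s ≠ 1 := by
      intro h; have := congrArg Complex.re h; rw [hsre] at this; simp at this; linarith
    rw [hpoly, hw2, one_div (riemannZeta s), ← MertensBoundRH.zetaInv_of_ne_one hs1]
    have h1 := htrunc s (by rw [hsre]; linarith)
    have h2 := hmain s (by rw [hsre, hσ₀, hκ]; linarith)
    rw [hsim] at h2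
    have hT1 : 1 ≤ (1 + |τ|) ^ (1 / 8 : ℝ) := Real.one_le_rpow (by linarith [abs_nonneg τ]) (by norm_num)
    calc ‖∑ a ∈ Finset.range (N + 1), LSeries.term (smoothedMoebius X) s a - zetaInv s‖
        ≤ ‖∑ a ∈ Finset.range (N + 1), LSeries.term (smoothedMoebius X) s a -
            LSeries (smoothedMoebius X) s‖ + ‖LSeries (smoothedMoebius X) s - zetaInv s‖ :=
          norm_sub_le_norm_sub_add_norm_sub _ _ _
      _ ≤ η / 2 + η / 2 * (1 + |τ|) ^ (1 / 8 : ℝ) := by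
          rw [norm_sub_rev]; exact add_le_add h1 h2
      _ ≤ η * (1 + |τ|) ^ (1 / 8 : ℝ) := by nlinarith
  · -- at the point `1 + 2ε`
    set s : ℂ := 1 + 2 * ε with hs
    have hsre : s.re = 1 + 2 * ε := by simp [hs]
    have hsim : s.im = 0 := by simp [hs]
    have hs1 : s ≠ 1 := by
      intro h; have := congrArg Complex.re h; rw [hsre] at this; simp at this; linarith
    rw [hpoly, one_div (riemannZeta (1 + 2 * ε)), ← hs, ← MertensBoundRH.zetaInv_of_ne_one hs1]
    have h1 := htrunc s (by rw [hsre]; linarith)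
    have h2 := hmain s (by rw [hsre, hσ₀, hκ]; linarith)
    rw [hsim] at h2
    simp only [abs_zero, add_zero, Real.one_rpow, mul_one] at h2
    calc ‖∑ a ∈ Finset.range (N + 1), LSeries.term (smoothedMoebius X) s a - zetaInv s‖
        ≤ ‖∑ a ∈ Finset.range (N + 1), LSeries.term (smoothedMoebius X) s a -
            LSeries (smoothedMoebius X) s‖ + ‖LSeries (smoothedMoebius X) s - zetaInv s‖ :=
          norm_sub_le_norm_sub_add_norm_sub _ _ _
      _ ≤ η / 2 + η / 2 := by rw [norm_sub_rev]; exact add_le_add h1 h2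
      _ = η := by ring

/-- **The deep half of Báez-Duarte's Theorem 1.1** (`Literature.NumberTheory.LFunctions.baezDuarte_onlyIf`): under RH,
`χ ∈ closure_{L²(0,∞)} span{ρ_a : a ∈ ℕ}`. From `baezDuarte_onlyIf_of_approx` fed with the
Mellin–Barnes approximation property (`invZetaDirichletApprox_of_RH`), Lemma 2.2
(`baezDuarte_zetaRatio_bound_holds`) and Titchmarsh (14.2.5)
(`zeta_isBigO_rpow_of_riemannHypothesis_holds`). [cite: BaezDuarte2003, Thm. 1.1 and §2.2] -/
theorem baezDuarte_onlyIf_holds : baezDuarte_onlyIf :=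
  baezDuarte_onlyIf_of_approx (fun hRH _ hε0 hε1 ↦ invZetaDirichletApprox_of_RH hRH hε0 hε1)
    baezDuarte_zetaRatio_bound_holds zeta_isBigO_rpow_of_riemannHypothesis_holds

/-- **Báez-Duarte's Theorem 1.1** (discharge of `Literature.NumberTheory.LFunctions.baezDuarte_iff`): the Riemann hypothesis
holds iff `χ = 𝟙_{(0,1]}` is in the `L²((0,∞))`-closure of the span of `x ↦ {1/(kx)}`, `k ∈ ℕ`.
[cite: BaezDuarte2003, Thm. 1.1] -/
theorem baezDuarte_iff_holds : baezDuarte_iff :=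
  baezDuarte_iff_of_onlyIf baezDuarte_onlyIf_holds

end Literature.NumberTheory.LFunctions

end
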